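import Mathlib
import HarnessLib
import Literature.Computability.AlgebraicComplexity.PatternExpressions
import Summits.ValiantsHypothesis.ValiantsHypothesis.Theorems.MonotoneRestorationMonotoneRestorationQPLinearWidthDefs
import Summits.ValiantsHypothesis.ValiantsHypothesis.Theorems.MonotoneRestorationMonotoneRestorationQPLinearWidthKroneckerMonotonicity

/-!
# Route MonotoneRestoration, crux `MonotoneRestorationQP` (stmt-15886), line `linear_width` —
# DETERMINEDNESS DESCENDS ALONG KRONECKER RESTRICTIONS: the weighted non-uniform closure is monotone under divisibility

Helper file (`--supports stmt-ValiantsHypothesis-15886`), def-free.  Companion of `…LinearWidthKroneckerMonotonicity.lean`.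
There the scalar Kronecker factor was the SMALL level `ν` and the variables lived at level `m`; here the roles are exchanged:
restricting a `HomIndist N k`-determined polynomial `p` (level `N`, `Fin N ≃ Fin m × Fin ν`) to the Kronecker slice
`{y ⊗ z : z ∈ ℂ^{ν×ν}}` through a FIXED weighted `y ∈ ℂ^{m×m}` gives a `HomIndist ν k`-determined polynomial at level `ν`:

* `homIndist_kronecker_left` — `HomIndist ν k z z' → HomIndist N k (y ⊗ z) (y ⊗ z')` with the scalar factor written FIRST
  (the congruence of `KroneckerMonotonicity.homIndist_kronecker`, transported along `Equiv.prodComm`);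
* `determined_kroneckerRestrict` — if `p` is determined by `HomIndist N k` then, for every weighted `y ∈ ℂ^{m×m}`, the level-`ν`
  polynomial `x_{pq} ↦` (substitute `y_{(e p).1,(e q).1} · x_{(e p).2,(e q).2}`) of `p` is determined by `HomIndist ν k`
  — the determined algebras `D_k(N)` restrict INTO `D_k(ν)` whenever `ν ∣ N`;
* `eval_homPoly_eq_of_homPoly_determined_mul` — in particular for a single pattern: if `hom_{F,m·ν}` is `HomIndist (m·ν) k`-
  determined and `m ≥ 1`, then `hom_{F,ν}` is `HomIndist ν k`-determined (slice through the all-ones `y = J_m`, where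
  `hom_F(J_m ⊗ z) = m^{|A|+|B|} · hom_F(z)` and `m^{|A|+|B|} ≠ 0`): the weighted non-uniform homomorphism-distinguishing
  closure satisfies `cl_{m·ν} ⊆ cl_ν` — Dawar–Pago–Seppelt 2025 Lem. B.1-type monotonicity, here for complex weights and
  with no padding.

Honest label: bookkeeping for the weighted closure calculus of the rung; no stub closed; VP ≠ VNP NOT moved.
[cite: DawarPagoSeppelt2025, §7.1.1 and App. B; Lovasz1967, §2]
-/

set_option linter.dupNamespace false

noncomputable section

open scoped Classical

namespace Summit.ValiantsHypothesis.ValiantsHypothesis.Theorems.KroneckerMonotonicity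

open MvPolynomial Literature.Computability.AlgebraicComplexity
open Summit.ValiantsHypothesis.ValiantsHypothesis.Theorems.MonotoneRestorationQPLinearWidth

/-- The Kronecker congruence with the scalar factor written first: `HomIndist ν k z z'` gives
`HomIndist N k (y ⊗_e z) (y ⊗_e z')` for `e : Fin N ≃ Fin m × Fin ν` and every weighted `y ∈ ℂ^{m×m}`.
[cite: DawarPagoSeppelt2025, Thm 7.11 (Claim 3); Lovasz1967, §2] -/
theorem homIndist_kronecker_left {N m ν k : ℕ} (e : Fin N ≃ Fin m × Fin ν) (y : Fin m × Fin m → ℂ)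
    {z z' : Fin ν × Fin ν → ℂ} (h : HomIndist ν k z z') :
    HomIndist N k (fun pq : Fin N × Fin N => y ((e pq.1).1, (e pq.2).1) * z ((e pq.1).2, (e pq.2).2))
      (fun pq : Fin N × Fin N => y ((e pq.1).1, (e pq.2).1) * z' ((e pq.1).2, (e pq.2).2)) := by
  have h' := homIndist_kronecker e h y
  simp only [mul_comm (z _) (y _), mul_comm (z' _) (y _)] at h'
  exact h'

/-- **Determinedness descends along Kronecker restrictions.**  If `p` (level `N`, `e : Fin N ≃ Fin m × Fin ν`) is determined
by `HomIndist N k`, then for every fixed weighted `y ∈ ℂ^{m×m}` the level-`ν` polynomial obtained by substituting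
`x_{pq} ↦ y_{(e p).1,(e q).1} · x_{(e p).2,(e q).2}` is determined by `HomIndist ν k`. [cite: DawarPagoSeppelt2025, App. B] -/
theorem determined_kroneckerRestrict {N m ν k : ℕ} (e : Fin N ≃ Fin m × Fin ν)
    {p : MvPolynomial (Fin N × Fin N) ℂ}
    (hdet : ∀ A B : Fin N × Fin N → ℂ, HomIndist N k A B → eval A p = eval B p)
    (y : Fin m × Fin m → ℂ) (z z' : Fin ν × Fin ν → ℂ) (h : HomIndist ν k z z') :
    eval z (aeval (fun pq : Fin N × Fin N =>
        (C (y ((e pq.1).1, (e pq.2).1)) * X ((e pq.1).2, (e pq.2).2) : MvPolynomial (Fin ν × Fin ν) ℂ)) p) =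
      eval z' (aeval (fun pq : Fin N × Fin N =>
        (C (y ((e pq.1).1, (e pq.2).1)) * X ((e pq.1).2, (e pq.2).2) : MvPolynomial (Fin ν × Fin ν) ℂ)) p) := by
  -- the substitution along `e` with scalars in the first factor is the substitution along `e.trans prodComm`
  -- with scalars in the second factor, to which `eval_kroneckerSubst` applies
  have hfun : (fun pq : Fin N × Fin N =>
      (C (y ((e pq.1).1, (e pq.2).1)) * X ((e pq.1).2, (e pq.2).2) : MvPolynomial (Fin ν × Fin ν) ℂ)) =
      fun pq : Fin N × Fin N =>
        (C (y (((e.trans (Equiv.prodComm _ _)) pq.1).2, ((e.trans (Equiv.prodComm _ _)) pq.2).2)) *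
          X (((e.trans (Equiv.prodComm _ _)) pq.1).1, ((e.trans (Equiv.prodComm _ _)) pq.2).1) :
            MvPolynomial (Fin ν × Fin ν) ℂ) := by
    funext pq
    simp
  rw [hfun, eval_kroneckerSubst, eval_kroneckerSubst]
  refine hdet _ _ ?_
  have h' := homIndist_kronecker_left e y h
  simpa using h'

/-- The homomorphism polynomial at the all-ones point is the number of vertex maps: `hom_F(J_m) = m^{|A|+|B|}`.
[folklore] -/
theorem eval_one_homPoly {A B : Type} [Fintype A] [DecidableEq A] [Fintype B] [DecidableEq B]
    (E : Multiset (A × B)) (m : ℕ) :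
    eval (fun _ : Fin m × Fin m => (1 : ℂ)) (homPoly E m ℂ) = (m : ℂ) ^ (Fintype.card A + Fintype.card B) := by
  unfold homPoly
  rw [map_sum]
  simp only [map_multiset_prod, Multiset.map_map, Function.comp_def, eval_X, Multiset.map_const',
    Multiset.prod_replicate, one_pow, Finset.sum_const, Finset.card_univ, nsmul_eq_mul, mul_one]
  rw [Fintype.card_prod, Fintype.card_fun, Fintype.card_fun, Fintype.card_fin, pow_add]
  push_cast
  ring

/-- **`cl_{m·ν} ⊆ cl_ν` for the weighted non-uniform homomorphism-distinguishing closure.**  If the homomorphism polynomial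
of a pattern `F` at level `m·ν` (`m ≥ 1`) is determined by `HomIndist (m·ν) k`, then its homomorphism polynomial at level `ν`
is determined by `HomIndist ν k` (Kronecker slice through the all-ones `J_m`: `hom_F(J_m ⊗ z) = m^{|A|+|B|} · hom_F(z)`).
[cite: DawarPagoSeppelt2025, §7.1.1 and App. B; Lovasz1967, §2] -/
theorem eval_homPoly_eq_of_homPoly_determined_mul {a b m ν k : ℕ} (hm : 1 ≤ m) (E : Multiset (Fin a × Fin b))
    (hdet : ∀ A B : Fin (m * ν) × Fin (m * ν) → ℂ, HomIndist (m * ν) k A B →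
      eval A (homPoly E (m * ν) ℂ) = eval B (homPoly E (m * ν) ℂ))
    {z z' : Fin ν × Fin ν → ℂ} (h : HomIndist ν k z z') :
    eval z (homPoly E ν ℂ) = eval z' (homPoly E ν ℂ) := by
  -- the Kronecker slice through `J_m`; for the identification below the scalar factor is written second along `prodComm`
  set e : Fin (m * ν) ≃ Fin ν × Fin m := finProdFinEquiv.symm.trans (Equiv.prodComm _ _) with he
  have hres := determined_kroneckerRestrict (finProdFinEquiv.symm : Fin (m * ν) ≃ Fin m × Fin ν) hdet
    (fun _ : Fin m × Fin m => (1 : ℂ)) z z' h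
  -- identify the restricted polynomial: `hom_F(J_m ⊗ x) = m^{|A|+|B|} · hom_F(x)`
  have hsub : aeval (fun pq : Fin (m * ν) × Fin (m * ν) =>
      (C ((fun _ : Fin m × Fin m => (1 : ℂ)) ((finProdFinEquiv.symm pq.1).1, (finProdFinEquiv.symm pq.2).1)) *
        X ((finProdFinEquiv.symm pq.1).2, (finProdFinEquiv.symm pq.2).2) : MvPolynomial (Fin ν × Fin ν) ℂ))
      (homPoly E (m * ν) ℂ) = C ((m : ℂ) ^ (a + b)) * homPoly E ν ℂ := by
    have h1 := HomTensor.homPoly_kronecker_eval E e ℂ (fun _ : Fin m × Fin m => (1 : ℂ))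
    rw [eval_one_homPoly, Fintype.card_fin, Fintype.card_fin] at h1
    rw [← h1]
    congr 1
  rw [hsub, map_mul, map_mul, eval_C, eval_C] at hres
  have hne : ((m : ℂ) ^ (a + b)) ≠ 0 := pow_ne_zero _ (by exact_mod_cast (Nat.one_le_iff_ne_zero.1 hm))
  exact mul_left_cancel₀ hne hres

end Summit.ValiantsHypothesis.ValiantsHypothesis.Theorems.KroneckerMonotonicity

end
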